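import Literature.MathematicalPhysics.QuantumLattice.LatticeGaugeDLRGibbsProofs
import Literature.MathematicalPhysics.QuantumFieldTheory.LatticeGaugeProofs
import HarnessLib

/-!
# Torus Wilson states: the local DLR equation with a far factor; moments of separated local observables

Sibling proof file of `Literature/MathematicalPhysics/QuantumLattice/LatticeGaugeDLR.lean`, next to
`LatticeGaugeDLRGibbsProofs.lean` (whose `wilsonExpectation_toTorusObservable_eq` is the case `H = 1` of §1 below).
No definition and no new named fact is introduced; every intermediate result is proved here.

* §1 `integral_torusLift_mul_eq_integral_ymSpecification_mul`: the torus Wilson state `μ_{Λ_L, β}` satisfies the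
  local DLR equation of the lattice Yang–Mills specification `ymSpecification ρ β Λ` **in the presence of a far
  factor**: for a bounded continuous cylinder observable `F` on `ℤ^d` whose support, together with `Λ` and the
  edges of the plaquettes touching `Λ`, injects into the torus, and a bounded measurable torus observable `H`
  that does not feel the torus links over `Λ`,
  `∫ F(lift V) H(V) dμ(V) = ∫ (γ_Λ F)(lift V) H(V) dμ(V)`
  (Georgii 2011, proof of Thm. 4.17, (4.18): `μ(F H) = μ((γ_Λ F) H)` for `𝓕_{Λᶜ}`-measurable `H`; Friedli–Velenik
  2017, Lemma 6.7 and (6.34)).  The proof is the tree's proof of `wilsonExpectation_toTorusObservable_eq` with the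
  far factor threaded through: the far part of the torus action and `H` are both invariant under resampling of the
  links over `Λ`, so the finite-volume DLR identity in resampling form (`integral_exp_mul_eq_integral_exp_mul_condAvg`)
  applies to the observable `(F ∘ lift) · H`, whose conditional Gibbs average over `Λ` is `((γ_Λ F) ∘ lift) · H`.
* §2 small measure-theoretic helpers (integrals against probability measures, products of bounded functions).
* §3 torus geometry: the cyclic representative, injectivity of `Torus.proj` on small sup-norm balls, and the
  separation lemma (balls around centres at cyclic distance `> ϱ + ϱ'` in some coordinate have disjoint images in
  the torus); edges of plaquettes touching `Λ` are within sup-distance `1` of `Λ`.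
* §4 `abs_integral_prod_sub_mean_le`, **moments of separated local observables**: if `A₁, …, Aₙ` are bounded
  continuous cylinder observables and `Λ₁, …, Λₙ` link sets, each `Λᵢ ∪ supp Aᵢ ∪ ∂Λᵢ` injecting into the torus and
  the torus images of `supp Aⱼ ∪ ∂Λⱼ` and `Λᵢ` disjoint for `i ≠ j`, and every kernel mean `γ_{Λᵢ} Aᵢ (η)` is within
  `ε` of a common value uniformly in the exterior `η`, then `|⟨∏ᵢ (Aᵢ − ⟨Aᵢ⟩)⟩_{Λ_L,β}| ≤ (2ε)ⁿ` — one DLR step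
  per site (§1, the other factors forming the far factor), i.e. the conditional independence of separated volumes
  for the nearest-neighbour plaquette interaction (Seiler LNP 159 Ch. 2; Georgii 2011 Thm. 4.17).

## References

* H.-O. Georgii, *Gibbs Measures and Phase Transitions*, 2nd ed. (de Gruyter 2011), Prop. 2.5, Thm. 4.17.
* S. Friedli, Y. Velenik, *Statistical Mechanics of Lattice Systems* (CUP 2017), Lemma 6.7, (6.34).
* E. Seiler, LNP 159 (Springer 1982), Ch. 2.
-/

set_option autoImplicit false

noncomputable section

open MeasureTheory Filter Topology Finset
open Literature.Probability.LatticeModels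
open Literature.MathematicalPhysics.QuantumFieldTheory (GaugeConfig Edge Plaquette plaquetteHolonomy wilsonAction
  wilsonMeasure haarProbability wilsonExpectation isProbabilityMeasure_wilsonMeasure)

namespace Literature.MathematicalPhysics.QuantumLattice

/-! ## §1 The torus DLR identity with a far factor -/

section FarFactorDLR

variable {d N : ℕ} {G : Type*} [Group G] [TopologicalSpace G] [IsTopologicalGroup G]
  [CompactSpace G] [MeasurableSpace G] [BorelSpace G] [SecondCountableTopology G]
  (ρ : G →* Matrix (Fin N) (Fin N) ℂ)

/-- **Torus Wilson states satisfy the local DLR equations of `ymSpecification`, with a far factor.**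
Let `F` be a bounded continuous cylinder observable on `ℤ^d` with support `S₀`, let the torus size `L` be so
large that reduction mod `L` is injective on the base points of `Λ ∪ S₀ ∪ ∂Λ` (`∂Λ` = edges of plaquettes
touching `Λ`), and let `H` be a bounded measurable observable of the torus configuration which is unchanged when
the links over (the image of) `Λ` are resampled.  Then
`∫ F(lift V) · H(V) dμ_{Λ_L,β}(V) = ∫ (γ_Λ F)(lift V) · H(V) dμ_{Λ_L,β}(V)`:
conditionally on the links outside the image of `Λ`, the links over `Λ` are distributed by the Wilson kernel
`γ_Λ(· | lift V)`, and `H` is measurable with respect to the conditioning.  Adapted (proof copied, far factor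
threaded) from the tree's `Literature.MathematicalPhysics.QuantumLattice.wilsonExpectation_toTorusObservable_eq`
(Georgii 2011, proof of Thm. 4.17, (4.18); Friedli–Velenik 2017, (6.34); Seiler LNP 159 Ch. 2). [folklore] -/
theorem integral_torusLift_mul_eq_integral_ymSpecification_mul (hρ : Continuous ρ) (β : ℝ)
    (Λ : Finset (ZdEdge d)) {F : LGConfig d G → ℝ} (hF : Continuous F) {C : ℝ} (hC : ∀ U, |F U| ≤ C)
    {S₀ : Finset (ZdEdge d)} (hFS : IsCylinder F S₀) {L : ℕ} [NeZero L]
    (hL : Set.InjOn (Torus.proj L)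
      ((Λ ∪ S₀ ∪ (plaquettesTouching Λ).biUnion plaquetteEdges).image Prod.fst :
        Set (Site d)))
    {H : GaugeConfig d L G → ℝ} (hHm : Measurable H) {D : ℝ} (hHD : ∀ V, |H V| ≤ D)
    (hH : ∀ W V, H ((Λ.image (torusEdge L)).piecewise W V) = H V) :
    ∫ V, F (torusLift L V) * H V ∂(wilsonMeasure ρ β) =
      ∫ V, (∫ U, F U ∂(ymSpecification ρ β Λ (torusLift L V))) * H V ∂(wilsonMeasure ρ β) := by
  classical
  -- the relevant finite edge set `T` and the injectivity consequences of `hL`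
  have hΛT : Λ ⊆ Λ ∪ S₀ ∪ (plaquettesTouching Λ).biUnion plaquetteEdges :=
    (subset_union_left).trans subset_union_left
  have hS₀T : S₀ ⊆ Λ ∪ S₀ ∪ (plaquettesTouching Λ).biUnion plaquetteEdges :=
    (subset_union_right).trans subset_union_left
  have hPT : (plaquettesTouching Λ).biUnion plaquetteEdges ⊆
      Λ ∪ S₀ ∪ (plaquettesTouching Λ).biUnion plaquetteEdges := subset_union_right
  have hTinj := injOn_torusEdge hL
  have hPinj := injOn_projPlaquette (image_subset_image hPT) hL
  -- near and far parts of the torus action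
  set a : GaugeConfig d L G → ℝ := fun V =>
    -β * ∑ q ∈ (plaquettesTouching Λ).image
        (fun p : ZdPlaquette d => ((Torus.proj L p.1, p.2) : Plaquette d L)),
      ((N : ℝ) - (ρ (plaquetteHolonomy V q.1 q.2.1.1 q.2.1.2)).trace.re)
    with ha_def
  set b : GaugeConfig d L G → ℝ := fun V =>
    -β * ∑ q ∈ ((plaquettesTouching Λ).image
        (fun p : ZdPlaquette d => ((Torus.proj L p.1, p.2) : Plaquette d L)))ᶜ,
      ((N : ℝ) - (ρ (plaquetteHolonomy V q.1 q.2.1.1 q.2.1.2)).trace.re)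
    with hb_def
  have hab : ∀ V, -β * wilsonAction ρ V = a V + b V := fun V => by
    simp only [ha_def, hb_def, wilsonAction, ← mul_add, Finset.sum_add_sum_compl]
  have ha : ∀ V, a V = -β * wilsonBoundaryAction ρ Λ (torusLift L V) := fun V => by
    simp only [ha_def, sum_image_proj_plaquetteTerm ρ hPinj]
  have hb : ∀ W V, b ((Λ.image (torusEdge L)).piecewise W V) = b V := fun W V => by
    simp only [hb_def]
    congr 1
    refine Finset.sum_congr rfl fun q hq => ?_
    rw [plaquetteHolonomy_piecewise_of_ne (fun p hp h => (Finset.mem_compl.1 hq)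
      (Finset.mem_image.2 ⟨p, hp, h⟩)) W V]
  have hac : Continuous a :=
    continuous_const.mul (continuous_finsetSum _ fun q _ => continuous_plaquetteTerm ρ hρ q)
  have hbc : Continuous b :=
    continuous_const.mul (continuous_finsetSum _ fun q _ => continuous_plaquetteTerm ρ hρ q)
  obtain ⟨A, hA⟩ := exists_bound_of_continuous hac
  obtain ⟨B, hB⟩ := exists_bound_of_continuous hbc
  have hFt : Continuous fun V : GaugeConfig d L G => F (torusLift L V) :=
    hF.comp (continuous_torusLift L)
  -- transfer of the fibre integrals from `G^Λ` to the torus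
  have hτ : Function.Injective fun e : ↥Λ => torusEdge L (e : ZdEdge d) := fun e₁ e₂ h =>
    Subtype.ext (hTinj (hΛT e₁.2) (hΛT e₂.2) h)
  have transfer : ∀ Φ : LGConfig d G → ℝ, Continuous Φ →
      DependsOn Φ ↑(Λ ∪ S₀ ∪ (plaquettesTouching Λ).biUnion plaquetteEdges) →
      ∀ V : GaugeConfig d L G,
        ∫ ζ, Φ (glueWith Λ ζ (torusLift L V)) ∂(Measure.pi fun _ : ↥Λ => haarProbability G) =
          ∫ W, Φ (torusLift L ((Λ.image (torusEdge L)).piecewise W V))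
            ∂(Measure.pi fun _ : Edge d L => haarProbability G) := by
    intro Φ hΦc hΦT V
    have hm : Measurable fun (W : GaugeConfig d L G) (e : ↥Λ) => W (torusEdge L (e : ZdEdge d)) :=
      measurable_pi_iff.2 fun e => measurable_pi_apply _
    have hc : Continuous fun ζ : ↥Λ → G => Φ (glueWith Λ ζ (torusLift L V)) :=
      hΦc.comp ((continuous_glueWith_prod Λ).comp (Continuous.prodMk_right (torusLift L V)))
    rw [← pi_map_comp_injective (haarProbability G) hτ,
      integral_map hm.aemeasurable hc.aestronglyMeasurable]
    refine congrArg _ (funext fun W => hΦT fun e he => ?_)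
    exact (torusLift_piecewise_apply hΛT hTinj W V he).symm
  -- locality of the two fibre integrands
  have hST : DependsOn (wilsonBoundaryAction (G := G) ρ Λ)
      ↑(Λ ∪ S₀ ∪ (plaquettesTouching Λ).biUnion plaquetteEdges) :=
    (isCylinder_wilsonBoundaryAction_holds (G := G) ρ Λ).mono (Finset.coe_subset.2 hPT)
  have hFT : DependsOn F ↑(Λ ∪ S₀ ∪ (plaquettesTouching Λ).biUnion plaquetteEdges) :=
    hFS.mono (Finset.coe_subset.2 hS₀T)
  have hw : Continuous fun U : LGConfig d G => Real.exp (-β * wilsonBoundaryAction ρ Λ U) :=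
    Real.continuous_exp.comp (continuous_const.mul (continuous_wilsonBoundaryAction ρ hρ Λ))
  -- the kernel average of `F` at a periodic boundary condition, computed on the torus
  have key : ∀ V : GaugeConfig d L G,
      ∫ U, F U ∂(ymSpecification ρ β Λ (torusLift L V)) =
        (∫ W, F (torusLift L ((Λ.image (torusEdge L)).piecewise W V)) *
            Real.exp (a ((Λ.image (torusEdge L)).piecewise W V))
            ∂(Measure.pi fun _ : Edge d L => haarProbability G)) /
          ∫ W, Real.exp (a ((Λ.image (torusEdge L)).piecewise W V))
            ∂(Measure.pi fun _ : Edge d L => haarProbability G) := by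
    intro V
    rw [integral_ymSpecification ρ hρ β Λ hF.measurable,
      transfer (fun U => F U * Real.exp (-β * wilsonBoundaryAction ρ Λ U)) (hF.mul hw)
        (fun x y h => by simp only [hFT h, hST h]),
      transfer (fun U => Real.exp (-β * wilsonBoundaryAction ρ Λ U)) hw
        (fun x y h => by simp only [hST h])]
    simp only [ha]
  -- conclude with the finite-volume DLR identity on the torus, for the observable `(F ∘ lift) · H`
  change wilsonExpectation ρ β (fun V => F (torusLift L V) * H V) =
    wilsonExpectation ρ β (fun V => (∫ U, F U ∂(ymSpecification ρ β Λ (torusLift L V))) * H V)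
  rw [wilsonExpectation_eq_toReal_mul_integral ρ hρ β,
    wilsonExpectation_eq_toReal_mul_integral ρ hρ β]
  congr 1
  simp only [key, hab, div_mul_eq_mul_div]
  exact integral_exp_mul_eq_integral_exp_mul_condAvg (haarProbability G)
    (Λ.image (torusEdge L)) (F := fun V => F (torusLift L V) * H V)
    (NF := fun V => (∫ W, F (torusLift L ((Λ.image (torusEdge L)).piecewise W V)) *
      Real.exp (a ((Λ.image (torusEdge L)).piecewise W V))
        ∂(Measure.pi fun _ : Edge d L => haarProbability G)) * H V)
    (N1 := fun V => ∫ W, Real.exp (a ((Λ.image (torusEdge L)).piecewise W V))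
        ∂(Measure.pi fun _ : Edge d L => haarProbability G))
    (hFt.measurable.mul hHm) hac.measurable hbc.measurable (C := C * D)
    (fun V => by
      rw [abs_mul]
      exact mul_le_mul (hC _) (hHD V) (abs_nonneg _) ((abs_nonneg _).trans (hC (torusLift L V))))
    hA hB hb
    (fun V => by
      simp only [hH]
      rw [← integral_mul_const]
      exact congrArg _ (funext fun W => by ring))
    (fun V => rfl)

/-- The far-factor DLR identity in `DependsOn` form: it suffices that `H` depends only on the torus links
off the image of `Λ`. [folklore] -/
theorem integral_torusLift_mul_eq_of_dependsOn_compl (hρ : Continuous ρ) (β : ℝ)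
    (Λ : Finset (ZdEdge d)) {F : LGConfig d G → ℝ} (hF : Continuous F) {C : ℝ} (hC : ∀ U, |F U| ≤ C)
    {S₀ : Finset (ZdEdge d)} (hFS : IsCylinder F S₀) {L : ℕ} [NeZero L]
    (hL : Set.InjOn (Torus.proj L)
      ((Λ ∪ S₀ ∪ (plaquettesTouching Λ).biUnion plaquetteEdges).image Prod.fst :
        Set (Site d)))
    {H : GaugeConfig d L G → ℝ} (hHm : Measurable H) {D : ℝ} (hHD : ∀ V, |H V| ≤ D)
    (hH : DependsOn H (↑(Λ.image (torusEdge L)) : Set (Edge d L))ᶜ) :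
    ∫ V, F (torusLift L V) * H V ∂(wilsonMeasure ρ β) =
      ∫ V, (∫ U, F U ∂(ymSpecification ρ β Λ (torusLift L V))) * H V ∂(wilsonMeasure ρ β) := by
  classical
  refine integral_torusLift_mul_eq_integral_ymSpecification_mul ρ hρ β Λ hF hC hFS hL hHm hHD
    fun W V => hH fun e he => ?_
  exact Finset.piecewise_eq_of_notMem _ _ _ fun h => he (Finset.mem_coe.2 h)

end FarFactorDLR

/-! ## §2 Small helpers: integrals against probability measures, products of bounded functions -/

section Helpers

/-- The integral of a function bounded by `C` against a probability measure is bounded by `C`. [folklore] -/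
theorem abs_integral_le_of_abs_le {X : Type*} [MeasurableSpace X] {μ : Measure X} [IsProbabilityMeasure μ]
    {f : X → ℝ} {C : ℝ} (hC : ∀ x, |f x| ≤ C) : |∫ x, f x ∂μ| ≤ C := by
  have h := norm_integral_le_of_norm_le_const (μ := μ) (f := f) (C := C)
    (ae_of_all _ fun x => by simpa [Real.norm_eq_abs] using hC x)
  simpa [Real.norm_eq_abs] using h

/-- A finite product of functions bounded by constants is bounded by the product of the constants. [folklore] -/
theorem abs_prod_le_prod {ι X : Type*} (s : Finset ι) {f : ι → X → ℝ} {B : ι → ℝ}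
    (h : ∀ i ∈ s, ∀ x, |f i x| ≤ B i) (x : X) : |∏ i ∈ s, f i x| ≤ ∏ i ∈ s, B i := by
  rw [Finset.abs_prod]
  exact Finset.prod_le_prod (fun i _ => abs_nonneg _) fun i hi => h i hi x

/-- A finite product of functions each bounded by the same constant `B` is bounded by `B ^ card`. [folklore] -/
theorem abs_prod_le_pow {ι X : Type*} (s : Finset ι) {f : ι → X → ℝ} {B : ℝ}
    (h : ∀ i ∈ s, ∀ x, |f i x| ≤ B) (x : X) : |∏ i ∈ s, f i x| ≤ B ^ s.card := by
  simpa using abs_prod_le_prod s (B := fun _ => B) h x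

/-- Bounded measurable functions are integrable against finite measures (`|f| ≤ C` form). [folklore] -/
theorem integrable_of_abs_le {X : Type*} [MeasurableSpace X] {μ : Measure X} [IsFiniteMeasure μ]
    {f : X → ℝ} (hf : Measurable f) {C : ℝ} (hC : ∀ x, |f x| ≤ C) : Integrable f μ :=
  Integrable.of_mem_Icc (-C) C hf.aemeasurable (ae_of_all _ fun x => abs_le.1 (hC x))

/-- Kernel / state averages commute with subtracting a constant: `∫ (f - c) dμ = ∫ f dμ - c` for a probability
measure and a bounded measurable `f`. [folklore] -/
theorem integral_sub_const_of_abs_le {X : Type*} [MeasurableSpace X] {μ : Measure X}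
    [IsProbabilityMeasure μ] {f : X → ℝ} (hf : Measurable f) {C : ℝ} (hC : ∀ x, |f x| ≤ C) (c : ℝ) :
    ∫ x, (f x - c) ∂μ = (∫ x, f x ∂μ) - c := by
  rw [integral_sub (integrable_of_abs_le hf hC) (integrable_const c), integral_const]
  simp

end Helpers


/-! ## §3 Torus geometry: cyclic distance, injectivity of the projection on small boxes, separation -/

section Geometry

variable {d : ℕ}

/-- The cyclic representative `valMinAbs (t mod M)` of an integer `t` is at most `|t|` in absolute value. [folklore] -/
theorem abs_valMinAbs_intCast_le (M : ℕ) [NeZero M] (t : ℤ) :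
    |(((t : ZMod M)).valMinAbs : ℤ)| ≤ |t| := by
  have h := ZMod.natAbs_min_of_le_div_two M _ _ (ZMod.coe_valMinAbs (t : ZMod M))
    (ZMod.natAbs_valMinAbs_le _)
  rw [Int.abs_eq_natAbs, Int.abs_eq_natAbs]
  exact_mod_cast h

/-- Reduction mod `M` is injective on the sup-norm ball of radius `ϱ` around any site as soon as `2ϱ < M`. [folklore] -/
theorem injOn_torusProj_of_near {M : ℕ} (x : Site d) {ϱ : ℤ} (hϱ : 2 * ϱ < M) :
    Set.InjOn (Torus.proj M) {y : Site d | ∀ j, |y j - x j| ≤ ϱ} := by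
  intro y hy y' hy' h
  funext j
  have h1 : ((y j : ℤ) : ZMod M) = ((y' j : ℤ) : ZMod M) := congr_fun h j
  rw [ZMod.intCast_eq_intCast_iff_dvd_sub] at h1
  have h2 := abs_sub_le (y' j) (x j) (y j)
  rw [abs_sub_comm (x j)] at h2
  have h3 : |y' j - y j| < (M : ℤ) := by linarith [hy j, hy' j]
  linarith [Int.eq_zero_of_abs_lt_dvd h1 h3]

/-- **Separated boxes do not meet on the torus.**  If in some coordinate `k` the cyclic distance of `x k` and
`x' k` mod `M` exceeds `ϱ + ϱ'`, then no site within sup-distance `ϱ'` of `x'` has the same reduction mod `M`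
as a site within sup-distance `ϱ` of `x`. [folklore] -/
theorem torusProj_ne_of_separated {M : ℕ} [NeZero M] {x x' y y' : Site d} {ϱ ϱ' : ℤ} {k : Fin d}
    (hsep : ϱ + ϱ' < |((((x k - x' k : ℤ)) : ZMod M)).valMinAbs|)
    (hy : ∀ j, |y j - x' j| ≤ ϱ') (hy' : ∀ j, |y' j - x j| ≤ ϱ) :
    Torus.proj M y ≠ Torus.proj M y' := by
  intro h
  have h1 : ((y k : ℤ) : ZMod M) = ((y' k : ℤ) : ZMod M) := by
    have := congr_fun h k
    simpa [Torus.proj_apply] using this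
  have h2 : (((x k - x' k : ℤ)) : ZMod M) = ((((x k - y' k) + (y k - x' k) : ℤ)) : ZMod M) := by
    push_cast
    rw [h1]
    ring
  rw [h2] at hsep
  have h3 := abs_valMinAbs_intCast_le M ((x k - y' k) + (y k - x' k))
  have h4 : |(x k - y' k) + (y k - x' k)| ≤ ϱ + ϱ' :=
    (abs_add_le _ _).trans (add_le_add (by rw [abs_sub_comm]; exact hy' k) (hy k))
  linarith

/-- Edge form of `torusProj_ne_of_separated`: edges of `ℤ^d` based in separated boxes have distinct images in
the torus. [folklore] -/
theorem torusEdge_ne_of_separated {M : ℕ} [NeZero M] {x x' : Site d} {ϱ ϱ' : ℤ} {k : Fin d}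
    (hsep : ϱ + ϱ' < |((((x k - x' k : ℤ)) : ZMod M)).valMinAbs|)
    {e e' : ZdEdge d}
    (he : ∀ j, |e.1 j - x' j| ≤ ϱ') (he' : ∀ j, |e'.1 j - x j| ≤ ϱ) :
    torusEdge M e ≠ torusEdge M e' := fun h =>
  torusProj_ne_of_separated hsep he he' (congrArg Prod.fst h)

/-- An edge of a plaquette touching `Λ` lies within sup-distance `1` of the base point of an edge of `Λ`
(the four edges of a plaquette at `y` are based at `y`, `y + eᵢ`, `y + eⱼ`). [folklore] -/
theorem exists_near_of_mem_plaquettesTouching_biUnion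
    {Λ : Finset (ZdEdge d)}
    {e : ZdEdge d}
    (he : e ∈ (plaquettesTouching Λ).biUnion plaquetteEdges) :
    ∃ e₀ ∈ Λ, ∀ j, |e.1 j - e₀.1 j| ≤ 1 := by
  obtain ⟨p, hp, hep⟩ := Finset.mem_biUnion.1 he
  obtain ⟨e₀, he₀⟩ := mem_plaquettesTouching_iff.1 hp
  rw [Finset.mem_inter] at he₀
  refine ⟨e₀, he₀.2, fun j => ?_⟩
  have key : ∀ e' ∈ plaquetteEdges p, 0 ≤ e'.1 j - p.1 j ∧ e'.1 j - p.1 j ≤ 1 := by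
    intro e' he'
    simp only [plaquetteEdges, Finset.mem_insert, Finset.mem_singleton] at he'
    rcases he' with rfl | rfl | rfl | rfl <;> simp [Pi.single_apply] <;> split_ifs <;> simp
  obtain ⟨h1, h2⟩ := key e hep
  obtain ⟨h3, h4⟩ := key e₀ he₀.1
  rw [abs_le]
  constructor <;> linarith

/-- A cylinder observable on `ℤ^d` whose support misses `Λ` on the torus does not feel the resampling of the
torus links over `Λ`. [folklore] -/
theorem apply_torusLift_piecewise_eq {G α : Type*} {L : ℕ}
    {Λ T : Finset (ZdEdge d)} {g : LGConfig d G → α}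
    (hg : IsCylinder g T) (hdisj : ∀ e ∈ T, ∀ e' ∈ Λ, torusEdge L e ≠ torusEdge L e')
    (W V : GaugeConfig d L G) :
    g (torusLift L ((Λ.image (torusEdge L)).piecewise W V)) = g (torusLift L V) := by
  classical
  refine hg fun e he => ?_
  simp only [torusLift, Function.comp_apply]
  refine Finset.piecewise_eq_of_notMem _ _ _ fun hmem => ?_
  obtain ⟨e', he', h⟩ := Finset.mem_image.1 hmem
  exact hdisj e (Finset.mem_coe.1 he) e' he' h.symm

end Geometry

/-! ## §4 The abstract collar bound: `n` separated volumes, one DLR step each -/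

section Collar

variable {d N : ℕ} {G : Type*} [Group G] [TopologicalSpace G] [IsTopologicalGroup G]
  [CompactSpace G] [MeasurableSpace G] [BorelSpace G] [SecondCountableTopology G]
  (ρ : G →* Matrix (Fin N) (Fin N) ℂ)

/-- **Abstract collar transfer.**  On the torus of side `L`, let `A₁, …, Aₙ` be bounded continuous cylinder
observables of `ℤ^d` (supports `Sᵢ`) read through the periodic lift, and `Λ₁, …, Λₙ` finite link sets such that
(i) each `Λᵢ ∪ Sᵢ ∪ ∂Λᵢ` injects into the torus and (ii) for `i ≠ j` the torus images of `Sⱼ ∪ ∂Λⱼ` and of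
`Λᵢ` are disjoint.  If every kernel mean `(γ_{Λᵢ} Aᵢ)(η)` is within `ε` of a common value `p`, uniformly in
the exterior `η`, then the centred `n`-th moment of the `Aᵢ` in the torus Wilson state is at most `(2ε)ⁿ`.
Proof: one DLR step per site (`integral_torusLift_mul_eq_integral_ymSpecification_mul`, the already collared
factors `hⱼ = γ_{Λⱼ}Aⱼ − ⟨Aⱼ⟩` and the raw factors `Aⱼ − ⟨Aⱼ⟩`, `j ≠ i`, forming the far factor) turns
`⟨∏ (Aᵢ − ⟨Aᵢ⟩)⟩` into `⟨∏ hᵢ⟩`; the torus mean `⟨Aᵢ⟩ = ⟨γ_{Λᵢ}Aᵢ⟩` is itself within `ε` of `p`, so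
`‖hᵢ‖_∞ ≤ 2ε` (Georgii 2011, Thm. 4.17 / (4.18); conditional independence of separated volumes for a
nearest-neighbour plaquette interaction, Seiler LNP 159 Ch. 2). [folklore] -/
theorem abs_integral_prod_sub_mean_le (hρ : Continuous ρ) (β : ℝ) {L : ℕ} [NeZero L] {n : ℕ}
    (Λ S : Fin n → Finset (ZdEdge d))
    (A : Fin n → LGConfig d G → ℝ) (hAc : ∀ i, Continuous (A i)) {CA : ℝ} (hAb : ∀ i U, |A i U| ≤ CA)
    (hAS : ∀ i, IsCylinder (A i) (S i))
    (hinj : ∀ i, Set.InjOn (Torus.proj L)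
      ((Λ i ∪ S i ∪ (plaquettesTouching (Λ i)).biUnion plaquetteEdges).image Prod.fst : Set (Site d)))
    (hfar : ∀ i j, i ≠ j → ∀ e ∈ S j ∪ (plaquettesTouching (Λ j)).biUnion plaquetteEdges, ∀ e' ∈ Λ i,
      torusEdge L e ≠ torusEdge L e')
    (m : Fin n → ℝ) (hm : ∀ i, m i = ∫ W, A i (torusLift L W) ∂(wilsonMeasure ρ β))
    {p ε : ℝ} (hker : ∀ i η, |(∫ U, A i U ∂(ymSpecification ρ β (Λ i) η)) - p| ≤ ε) :
    |∫ V, ∏ i, (A i (torusLift L V) - m i) ∂(wilsonMeasure ρ β)| ≤ (2 * ε) ^ n := by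
  classical
  haveI := isProbabilityMeasure_wilsonMeasure (d := d) (L := L) ρ hρ β
  -- kernel means and collared observables
  set g : Fin n → LGConfig d G → ℝ := fun i η => ∫ U, A i U ∂(ymSpecification ρ β (Λ i) η) with hgdef
  set h : Fin n → LGConfig d G → ℝ := fun i η => g i η - m i with hhdef
  have hgcyl : ∀ i, IsCylinder (g i) (S i ∪ (plaquettesTouching (Λ i)).biUnion plaquetteEdges) := fun i =>
    dependsOn_integral_ymSpecification ρ hρ β (Λ i) (hAc i).measurable (hAS i)
  have hgc : ∀ i, Continuous (g i) := fun i =>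
    continuous_integral_ymSpecification ρ hρ β (Λ i) (hAc i) (hAb i)
  have hgb : ∀ i η, |g i η| ≤ CA := fun i η => abs_integral_ymSpecification_le ρ hρ β (Λ i) (hAb i) η
  -- the torus mean is the torus mean of the kernel mean (DLR step with trivial far factor)
  have hm' : ∀ i, m i = ∫ V, g i (torusLift L V) ∂(wilsonMeasure ρ β) := fun i => by
    have h1 := integral_torusLift_mul_eq_integral_ymSpecification_mul ρ hρ β (Λ i) (hAc i) (hAb i)
      (hAS i) (hinj i) (H := fun _ => (1 : ℝ)) measurable_const (D := 1) (fun _ => by simp)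
      (fun _ _ => rfl)
    rw [hm i]
    simpa [hgdef] using h1
  have hmp : ∀ i, |m i - p| ≤ ε := fun i => by
    have e1 : m i - p = ∫ V, (g i (torusLift L V) - p) ∂(wilsonMeasure ρ β) := by
      rw [hm' i, integral_sub_const_of_abs_le (f := fun V => g i (torusLift L V))
        ((hgc i).comp (continuous_torusLift L)).measurable (fun V => hgb i _) p]
    rw [e1]
    exact abs_integral_le_of_abs_le fun V => hker i _
  -- sup bound on the collared observables
  have hhb : ∀ i η, |h i η| ≤ 2 * ε := fun i η => by
    have e1 : h i η = (g i η - p) - (m i - p) := by simp only [hhdef]; ring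
    rw [e1, two_mul]
    exact (abs_sub _ _).trans (add_le_add (hker i η) (hmp i))
  have hhcyl : ∀ i, IsCylinder (h i) (S i ∪ (plaquettesTouching (Λ i)).biUnion plaquetteEdges) :=
    fun i U V hUV => by simp only [hhdef, hgcyl i hUV]
  have hhc : ∀ i, Continuous (h i) := fun i => (hgc i).sub continuous_const
  -- far factors do not feel the links over `Λ i`
  have hhfar : ∀ i j, i ≠ j → ∀ W V,
      h j (torusLift L (((Λ i).image (torusEdge L)).piecewise W V)) = h j (torusLift L V) :=
    fun i j hij W V => apply_torusLift_piecewise_eq (hhcyl j) (hfar i j hij) W V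
  have hAfar : ∀ i j, i ≠ j → ∀ W V,
      A j (torusLift L (((Λ i).image (torusEdge L)).piecewise W V)) = A j (torusLift L V) :=
    fun i j hij W V => apply_torusLift_piecewise_eq (hAS j)
      (fun e he => hfar i j hij e (Finset.mem_union_left _ he)) W V
  -- the collar identity, by induction on the set `T` of already collared sites
  have hcollar : ∀ T : Finset (Fin n),
      ∫ V, (∏ i ∈ T, h i (torusLift L V)) * ∏ i ∈ Tᶜ, (A i (torusLift L V) - m i)
          ∂(wilsonMeasure ρ β) =
        ∫ V, ∏ i, (A i (torusLift L V) - m i) ∂(wilsonMeasure ρ β) := by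
    intro T
    induction T using Finset.induction_on with
    | empty => simp
    | @insert i T hiT ih =>
      rw [← ih]
      have hTc : Tᶜ = insert i (insert i T)ᶜ := (Finset.insert_compl_insert hiT).symm
      have hi' : i ∉ (insert i T)ᶜ := fun hh => (Finset.mem_compl.1 hh) (Finset.mem_insert_self i T)
      rw [hTc]
      simp only [Finset.prod_insert hiT, Finset.prod_insert hi']
      -- the far factor of the DLR step at `i`
      set H : GaugeConfig d L G → ℝ := fun V =>
        (∏ j ∈ T, h j (torusLift L V)) * ∏ j ∈ (insert i T)ᶜ, (A j (torusLift L V) - m j) with hHdef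
      have hHc : Continuous H :=
        (continuous_finsetProd T fun j _ => (hhc j).comp (continuous_torusLift L)).mul
          (continuous_finsetProd _ fun j _ =>
            ((hAc j).comp (continuous_torusLift L)).sub continuous_const)
      have hHb : ∀ V, |H V| ≤ (∏ j ∈ T, 2 * ε) * ∏ j ∈ (insert i T)ᶜ, (CA + |m j|) := fun V => by
        simp only [hHdef, abs_mul]
        refine mul_le_mul (abs_prod_le_prod T (f := fun j V => h j (torusLift L V)) (fun j _ V => hhb j _) V)
          (abs_prod_le_prod _ (f := fun j V => A j (torusLift L V) - m j)
            (fun j _ V => (abs_sub _ _).trans (add_le_add_left (hAb j _) _)) V)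
          (abs_nonneg _) ?_
        exact Finset.prod_nonneg fun j _ => (abs_nonneg _).trans (hhb j (torusLift L V))
      have hHpw : ∀ W V, H (((Λ i).image (torusEdge L)).piecewise W V) = H V := by
        intro W V
        simp only [hHdef]
        congr 1
        · exact Finset.prod_congr rfl fun j hj => hhfar i j (fun e => hiT (e ▸ hj)) W V
        · exact Finset.prod_congr rfl fun j hj => by rw [hAfar i j (fun e => hi' (e ▸ hj)) W V]
      have key := integral_torusLift_mul_eq_integral_ymSpecification_mul ρ hρ β (Λ i)
        (F := fun U => A i U - m i) ((hAc i).sub continuous_const) (C := CA + |m i|)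
        (fun U => (abs_sub _ _).trans (add_le_add_left (hAb i U) _)) (S₀ := S i)
        (fun U V hUV => by simp only [hAS i hUV]) (hinj i) hHc.measurable hHb hHpw
      have hkern : ∀ V, ∫ U, (A i U - m i) ∂(ymSpecification ρ β (Λ i) (torusLift L V)) =
          h i (torusLift L V) := by
        intro V
        haveI := isProbabilityMeasure_ymSpecification ρ hρ β (Λ i) (torusLift L V)
        simp only [hhdef, hgdef]
        exact integral_sub_const_of_abs_le (hAc i).measurable (hAb i) (m i)
      simp only [hkern] at key
      calc ∫ V, h i (torusLift L V) * (∏ j ∈ T, h j (torusLift L V)) *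
              ∏ j ∈ (insert i T)ᶜ, (A j (torusLift L V) - m j) ∂(wilsonMeasure ρ β)
          = ∫ V, h i (torusLift L V) * H V ∂(wilsonMeasure ρ β) := by
            refine integral_congr_ae (ae_of_all _ fun V => ?_)
            simp only [hHdef]
            ring
        _ = ∫ V, (A i (torusLift L V) - m i) * H V ∂(wilsonMeasure ρ β) := key.symm
        _ = ∫ V, (∏ j ∈ T, h j (torusLift L V)) * ((A i (torusLift L V) - m i) *
              ∏ j ∈ (insert i T)ᶜ, (A j (torusLift L V) - m j)) ∂(wilsonMeasure ρ β) := by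
            refine integral_congr_ae (ae_of_all _ fun V => ?_)
            simp only [hHdef]
            ring
  -- conclusion: all sites collared, sup bound under the probability measure
  have hfin := hcollar Finset.univ
  simp only [Finset.compl_univ, Finset.prod_empty, mul_one] at hfin
  rw [← hfin]
  calc |∫ V, ∏ i, h i (torusLift L V) ∂(wilsonMeasure ρ β)|
      ≤ (2 * ε) ^ (Finset.univ : Finset (Fin n)).card :=
        abs_integral_le_of_abs_le fun V => abs_prod_le_pow _ (fun i _ η => hhb i η) (torusLift L V)
    _ = (2 * ε) ^ n := by rw [Finset.card_univ, Fintype.card_fin]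

end Collar

end Literature.MathematicalPhysics.QuantumLattice

end
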